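import Summits.ABC.IUTFork.Cor312PilotKummerNaturalWitness
import Summits.ABC.IUTFork.Cor312LogKummerRoute
import Summits.ABC.IUTFork.Cor312PinnedFrameFlip
import HarnessLib

/-!
# [IUTchIII] Cor. 3.12 — the NATURAL bed P♮_β: abc-iut-w5-d230's P♮ with ONE field changed, `logvol_{j,v_ℚ} := natVol_{j,v_ℚ} + β(j)`

Record file (D-0012; MODEL DATA + proofs, no `Prop` fact) of the abc-iut cell, IUT REPAIR branch (rung LADDER-ABC:A2.RP; seat abc-iut-rp-m4
gen 2, engine E5 of row RP-M51, `Repair/CandMochizuki41` p440036; flat per RULINGS #14/#19, pattern of abc-iut-rp-d2's P♮⁺). TAKES NO SIDE on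
[IUTchIII] Cor. 3.12 or on any author; a model of READING PREDICATES is a consistency witness, not an endorsement; toy carriers; typed ≠ proved.

WHY. Every bed of the branch's table on which ⟨(Ind1)∪(Ind2)⟩ MOVES the Θ-region (P♮ p429573, P♮⁺) carries abc-iut-w5-d230's FOUR-LEVEL
volume `natVol` (`−3/−2/−2/−1/0`), the SAME at every label, so no row comparing volumes ACROSS the labels `j ∈ 𝔽_l^⋇` (honest `j²`-shapes, the
(LVEx) «ratio» of `Repair.CandMochizuki41`, per-label inflation rows) can be separated from its (Ind)-trivial profile by a region-moving bed.
P♮_β keeps EVERY datum of P♮ (sign shells, frame `natFrame`, `PsiNat`, identity Kummer transport, `naiveLink`, honest object side, glue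
`thetaRegionNat`/`qRegionNat`, operator `segRegion`, q-datum `qDatumNat = flipFamily·Ψ`) and replaces the log-volume by
`shiftVol β j v_ℚ A := natVol j v_ℚ A + β j` for an ARBITRARY per-label normalisation `β : Label → ℝ` (P♮ = `β ≡ 0`; the degrees of the
typed Thm. 3.11 (i)(c) shift accordingly, `deg_j = −1 + β j`). CLARIFICATION (v2, referee lane t defect T-g6-1, doc-only): PRINT PINS the packet
normalisation — [IUTchIII] `paper:url-4b091feeb646` Prop. 3.9 (i), p. 115 l. 35–44 / p. 116 l. 10–19: the log-volume is normalised so that the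
integral structure (the «tensor product log-shell» lattice) has log-volume `0` — so there is NO free per-label shift in print; the gauge `β` is a
freedom of the TYPED interface only (abc-iut-c312-1's `Thm311.MRData.logvol` is a bare datum of the typed Thm. 3.11 (i)(a) with no normalisation
axiom). P♮_β is therefore a model of the TYPED Theorem 3.11, used to separate typed candidates; it makes no claim about print's normalised volumes.
[claim: Mochizuki2012, status: disputed]

RESULTS (ns `Summit.ABC.IUTFork.Cor312Vol.NaturalShiftWitness`), for EVERY `β`: the model `shiftData`/`shiftSituation`/`shiftFull`/`shiftSetting`;
`shiftFull_statement` (typed Thm. 3.11 (i)–(iii)); regions/possible images/hulls AS IN P♮ (`shift_possibleImages` = the two half-shells,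
`shift_thetaHull = ball`); volumes `shift_thetaLocal = −1 + β j`, `shift_qLocal = −2 + β j`, own Θ-volume `shift_logvol_thetaRegion = −2 + β j`;
`shift_statement` (Statement ✓ ∀ β), `shift_absLogQPos` (β < 2 on 𝔽_l^⋆), `shift_bridgeHyps`, the THREE PINS `shift_pinnedRegions3` (segRegion,
qDatumNat), **S ✓ `shift_pilotKummerIndRelated` through the genuine (Ind2)-move `flipFamily`**, `shift_regions_ne`, engine `satShift_of_holds`.
§6 honest-Θ instance `βθ j := −2·(j² − 1)`: `shiftθ_numbers` (`thetaLocal = −1, −7`; own `−2, −8`; `−|log(Θ)| = −4`, `−|log(q)| = −5`; under S the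
Θ- and q-packet volumes agree, BAR-V, so the q-volume is label-dependent here). Nothing here grades any row.
-/

noncomputable section

open Set

namespace Summit.ABC.IUTFork.Cor312Vol

namespace NaturalShiftWitness

open Thm311 Cor312 Cor312.Checks Cor312.IdentifiedNonVacuity NaiveWitness PinnedWitness NaturalWitness Literature.IUT.LogThetaLattice

variable (β : toyIndex.Label → ℝ)

/-! ## 1. The model: P♮ with the log-volume shifted by `β j` on the packets of label `j` -/

/-- The SHIFTED four-level log-volume: `natVol + β j`. MODEL DATA. [claim: Mochizuki2012, status: disputed] -/
def shiftVol (j : toyIndex.Label) (vQ : toyIndex.VQ) (A : Set (signShells.Packet j vQ)) : ℝ := natVol j vQ A + β j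

/-- The shifted volume is monotone. [folklore] -/
theorem shiftVol_mono {j : toyIndex.Label} {vQ : toyIndex.VQ} {A B : Set (signShells.Packet j vQ)} (hAB : A ⊆ B) :
    shiftVol β j vQ A ≤ shiftVol β j vQ B := by
  unfold shiftVol; have h := natVol_mono hAB; linarith

/-- Its values on the hull-sets: `−3 + β, −2 + β, −2 + β, −1 + β, β`. [folklore] -/
theorem shiftVol_values (j : toyIndex.Label) (vQ : toyIndex.VQ) :
    shiftVol β j vQ {0} = -3 + β j ∧ shiftVol β j vQ (halfPos j vQ) = -2 + β j ∧ shiftVol β j vQ (halfNeg j vQ) = -2 + β j ∧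
      shiftVol β j vQ (ball j vQ) = -1 + β j ∧ shiftVol β j vQ Set.univ = β j := by
  obtain ⟨h1, h2, h3, h4, h5⟩ := natVol_values j vQ
  unfold shiftVol; exact ⟨by rw [h1], by rw [h2], by rw [h3], by rw [h4], by rw [h5, zero_add]⟩

/-- **The data (a)(b)(c) of P♮_β**: abc-iut-w5-d230's `natData` with the log-volume `shiftVol β`. MODEL DATA. [claim: Mochizuki2012, status: disputed] -/
def shiftData : MRData signShells :=
  { natData with logvol := fun j vQ A => shiftVol β j vQ A }

/-- (c)'s global realified Frobenioids: one object of degree `−1 + β j` = the global log-volume of its region `ball`. MODEL DATA.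
[claim: Mochizuki2012, status: disputed] -/
def shiftDegrees (j : toyIndex.LabelStar) : GlobalDegrees signShells j :=
  { natDegrees j with deg := fun _ => -1 + β j.1 }

/-- The SITUATION of P♮_β (same data on every vertical line). (An `abbrev`.) [claim: Mochizuki2012, status: disputed] -/
abbrev shiftSituation : Situation toyIndex where
  L := signShells
  D := fun _ => shiftData β
  G := fun _ j => shiftDegrees β j

/-- The COLUMN of P♮_β: P♮'s identity Kummer transport with the Frobenius-like volume the shifted one (so (ii)(a) holds by `rfl`).
MODEL DATA. [claim: Mochizuki2012, status: disputed] -/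
def shiftColumn : Column signShells :=
  { natColumn with frobLogvol := fun _ j vQ A => shiftVol β j vQ A }

/-- The FULL SITUATION of P♮_β: the shifted column on every line, link data abc-iut-w5-d247's `naiveLink`. (An `abbrev`.)
[claim: Mochizuki2012, status: disputed] -/
abbrev shiftFull : FullSituation toyIndex where
  toSituation := shiftSituation β
  col := fun _ => shiftColumn β
  link := naiveLink

/-- **The setting P♮_β of Cor. 3.12** over `shiftSituation β`: P♮'s setting field by field (honest object side, frame `natFrame`, glue
`thetaRegionNat`/`qRegionNat`). MODEL DATA. [claim: Mochizuki2012, status: disputed] -/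
def shiftSetting : Setting (shiftSituation β) where
  n := 0
  HT := ℤ × ℤ
  LogLink := fun _ _ => Unit
  IsFull := fun _ => True
  lattice :=
    { theater := fun n m => (n, m)
      distinct := fun p q h => by simpa using h
      logLink := fun _ _ => ()
      logLink_full := fun _ _ => trivial }
  Frd := Unit
  IsoF := fun _ _ => Unit
  Ob := fun _ => ℤ
  realify := id
  Strip := Unit
  IsoS := fun _ _ => Unit
  M := fun _ _ => ExpMonoid
  sig := pinSig
  split := { Msplit := fun _ _ => ⊤, exists_gen := fun _ _ => ⟨⟨gen, trivial⟩, top_gen_isGenerator⟩ }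
  ObΔ := ℤ
  N := fun _ _ => ExpMonoid
  qData :=
    { q := fun _ _ => gen
      q_gen := fun _ _ => gen_isGenerator
      objOf := fun x => (expOf (x () (Set.mem_univ ())) : ℤ) }
  frame := fun j vQ => natFrame j vQ
  hul_adm := fun _ _ _ _ => trivial
  thetaRegionOf := fun _ k j vQ => thetaRegionNat k j vQ
  qRegionOf := fun k j vQ => qRegionNat k j vQ
  qRegion_mem := fun j vQ => qRegionNat_one_mem_natHul j vQ
  qSupport_finite := fun _ => Set.toFinite _

/-! ## 2. The typed Theorem 3.11 holds for P♮_β -/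

/-- (i): splitting monoid in the sub-packets; degree `−1 + β j` IS the global log-volume of `ball`; the classes coincide. [folklore] -/
theorem shift_partI : (shiftFull β).PartI := by
  refine ⟨fun n v hv x _ j => ?_, fun n j k => ⟨fun vQ => trivial, Set.toFinite _, ?_⟩, fun _ _ => rfl⟩
  · show x j ∈ signShells.SubPacket j.1 v
    rw [subPacket_eq_top]; trivial
  · show (-1 + β j.1 : ℝ) = ∑ᶠ vQ : toyIndex.VQ, shiftVol β j.1 vQ (ball j.1 vQ)
    rw [finsum_unique]
    exact (shiftVol_values β j.1 _).2.2.2.1.symm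

/-- (ii): identity Kummer transport. [folklore] -/
theorem shift_partII : (shiftFull β).toLatticeSituation.PartII := fun _ =>
  (Column.partII_iff _ _).2
    ⟨fun _ _ _ _ _ => ⟨trivial, rfl⟩, fun _ _ _ => rfl, fun _ _ => rfl, fun _ _ _ _ _ => subset_rfl,
      fun _ _ _ h => absurd trivial h⟩

/-- (iii): abc-iut-w5-d247's `naiveLink`. [folklore] -/
theorem shift_partIII : (shiftFull β).PartIII := by
  refine ⟨naiveLink.partIIIa_holds, naiveLink.partIIIb_holds, ?_, fun n m => Thm311.PolyIsoCalc.stabilized_full _ _,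
    (shiftFull β).evalCompatUpToInd_of_multiradialCompat (shift_partI β).2.2⟩
  refine naiveLink.partIIIc_of_full (fun _ => rfl) fun n m => ?_
  rintro _ ⟨a, rfl⟩
  show unitIso a ≪≫ unitIso ((-1) ^ m.natAbs) = unitIso ((-1) ^ m.natAbs) ≪≫ unitIso a
  rw [unitIso_trans, unitIso_trans, mul_comm]

/-- **The typed Theorem 3.11 (i) ∧ (ii) ∧ (iii) HOLDS in P♮_β**, for every `β`. [folklore] -/
theorem shiftFull_statement : (shiftFull β).Statement := ⟨shift_partI β, shift_partII β, shift_partIII β⟩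

/-- `MultiradialCompat` (part of (i)). [folklore] -/
theorem shift_multiradialCompat : (shiftFull β).MultiradialCompat := (shift_partI β).2.2

/-! ## 3. Pilots, regions, hulls (P♮'s computations, verbatim for the new carrier) -/

/-- The pilots are the objects of exponent `1`. [folklore] -/
theorem shift_pilots : (shiftSetting β).thetaPilot = (1 : ℤ) ∧ (shiftSetting β).qPilot = (1 : ℤ) :=
  ⟨congrArg (Nat.cast : ℕ → ℤ)
    (expOf_eq_one_of_isGenerator_top (Classical.choose_spec ((shiftSetting β).split.exists_gen () (Set.mem_univ ())))), rfl⟩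

/-- The Kummer image of the Θ-pilot at `(m, j, v_ℚ)` is `thetaRegionNat 1`. [folklore] -/
theorem shift_thetaRegion (m : ℤ) (j : toyIndex.Label) (vQ : toyIndex.VQ) :
    (shiftSetting β).thetaRegion m j vQ = thetaRegionNat 1 j vQ := by
  unfold Setting.thetaRegion; rw [(shift_pilots β).1]; rfl

/-- The (Ind3)-enlarged Θ-region. [folklore] -/
theorem shift_thetaRegion3 (j : toyIndex.Label) (vQ : toyIndex.VQ) : (shiftSetting β).thetaRegion3 j vQ = thetaRegionNat 1 j vQ := by
  show (⋃ m : ℤ, (shiftSetting β).thetaRegion m j vQ) = _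
  simp_rw [shift_thetaRegion]; exact Set.iUnion_const _

/-- The q-pilot image. [folklore] -/
theorem shift_qRegion (j : toyIndex.Label) (vQ : toyIndex.VQ) : (shiftSetting β).qRegion j vQ = qRegionNat 1 j vQ := rfl

/-- On `𝔽_l^⋇`: Θ-region `halfPos`, q-region `halfNeg`. [folklore] -/
theorem shift_regions_of_ne_zero {j : toyIndex.Label} (hj : j ≠ 0) (vQ : toyIndex.VQ) :
    (shiftSetting β).thetaRegion3 j vQ = halfPos j vQ ∧ (shiftSetting β).qRegion j vQ = halfNeg j vQ := by
  rw [shift_thetaRegion3, shift_qRegion, thetaRegionNat_one_of_ne_zero hj, qRegionNat_one_of_ne_zero hj]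
  exact ⟨rfl, rfl⟩

/-- `flipFamily` lies in the (Ind1)(Ind2)-group. [folklore] -/
theorem flipFamily_mem_indGroup_shift : flipFamily ∈ Setting.indGroup (shiftSituation β) :=
  Subgroup.subset_closure (Or.inr flipFamily_mem_Ind2Family)

/-- The possible images at a label of `𝔽_l^⋇` are the two half-shells (the (Ind2)-family MOVES the Θ-region). [folklore] -/
theorem shift_possibleImages {j : toyIndex.Label} (hj : j ≠ 0) (vQ : toyIndex.VQ) :
    (shiftSetting β).possibleImages j vQ = {halfPos j vQ, halfNeg j vQ} := by
  ext U
  rw [Setting.possibleImages, (shift_regions_of_ne_zero β hj vQ).1]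
  constructor
  · rintro ⟨Φ, hΦ, rfl⟩
    rcases image_eq_or_of_actsBySigns (actsBySigns_of_mem_closure hΦ) j vQ (halfPos j vQ) with e | e
    · exact Or.inl e
    · rw [e, (negSet_hul j vQ).2.1]; exact Or.inr rfl
  · rintro (rfl | rfl)
    · exact ⟨1, (Setting.indGroup (shiftSituation β)).one_mem, by simp⟩
    · exact ⟨flipFamily, flipFamily_mem_indGroup_shift β, (image_halfPos_flipFamily j vQ).symm⟩

/-- At the zero label the only possible image is `{0}`. [folklore] -/
theorem shift_possibleImages_zero (vQ : toyIndex.VQ) : (shiftSetting β).possibleImages 0 vQ = {{0}} := by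
  ext U
  rw [Setting.possibleImages, shift_thetaRegion3, (regionNat_zero 1 vQ).1]
  constructor
  · rintro ⟨Φ, -, rfl⟩
    rw [Set.mem_singleton_iff, Set.image_singleton, map_zero]
  · rintro rfl
    exact ⟨1, (Setting.indGroup (shiftSituation β)).one_mem, by simp⟩

/-- The hull at a label of `𝔽_l^⋇` is the shell `ball`. [folklore] -/
theorem shift_thetaHull {j : toyIndex.Label} (hj : j ≠ 0) (vQ : toyIndex.VQ) : (shiftSetting β).thetaHull j vQ = ball j vQ := by
  unfold Setting.thetaHull
  rw [shift_possibleImages β hj, Set.sUnion_insert, Set.sUnion_singleton, halfPos_union_halfNeg]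
  exact (natFrame j vQ).hull_eq_self_of_mem (ball_mem_natHul j vQ)

/-- The hull at the zero label is `{0}`. [folklore] -/
theorem shift_thetaHull_zero (vQ : toyIndex.VQ) : (shiftSetting β).thetaHull 0 vQ = {0} := by
  unfold Setting.thetaHull
  rw [shift_possibleImages_zero, Set.sUnion_singleton]
  exact (natFrame 0 vQ).hull_eq_self_of_mem (zero_mem_natHul 0 vQ)

/-- Every union of possible images admits its hull. [folklore] -/
theorem shift_hullDefined (j : toyIndex.Label) (vQ : toyIndex.VQ) : (shiftSetting β).HullDefined j vQ := ⟨trivial, trivial⟩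

/-! ## 4. Volumes: the label-dependence is the point -/

/-- The local Θ-contribution at a label `j ∈ 𝔽_l^⋇` is `−1 + β j` (the shifted volume of the shell). [folklore] -/
theorem shift_thetaLocal (i : Fin toyIndex.lstar) (vQ : toyIndex.VQ) :
    (shiftSetting β).thetaLocal (Setting.labelSucc i) vQ = ((-1 + β (Setting.labelSucc i) : ℝ) : WithTop ℝ) := by
  unfold Setting.thetaLocal
  rw [if_pos (shift_hullDefined β _ vQ), shift_thetaHull β (Setting.labelSucc_ne_zero i)]
  exact congrArg _ (shiftVol_values β _ vQ).2.2.2.1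

/-- The local q-contribution at a label `j ∈ 𝔽_l^⋇` is `−2 + β j`. [folklore] -/
theorem shift_qLocal (i : Fin toyIndex.lstar) (vQ : toyIndex.VQ) :
    (shiftSetting β).qLocal (Setting.labelSucc i) vQ = -2 + β (Setting.labelSucc i) := by
  unfold Setting.qLocal
  rw [(shift_regions_of_ne_zero β (Setting.labelSucc_ne_zero i) vQ).2]
  exact (shiftVol_values β _ vQ).2.2.1

/-- The Θ-pilot's OWN packet volume at `(m, j, v_ℚ)`, `j ∈ 𝔽_l^⋇`, is `−2 + β j` (the shifted volume of the half-shell). [folklore] -/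
theorem shift_logvol_thetaRegion (m : ℤ) (i : Fin toyIndex.lstar) (vQ : toyIndex.VQ) :
    ((shiftSituation β).D (shiftSetting β).n).logvol _ vQ ((shiftSetting β).thetaRegion m (Setting.labelSucc i) vQ) =
      -2 + β (Setting.labelSucc i) := by
  rw [shift_thetaRegion, thetaRegionNat_one_of_ne_zero (Setting.labelSucc_ne_zero i)]
  exact (shiftVol_values β _ vQ).2.1

/-- `−|log(Θ)|` is finite. [folklore] -/
theorem shift_thetaFinite : (shiftSetting β).ThetaFinite :=
  ⟨fun i vQ => by rw [shift_thetaLocal]; exact WithTop.coe_ne_top, fun _ => Set.toFinite _⟩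

/-- `−|log(Θ)| = PN(j ↦ −1 + β j)`. [folklore] -/
theorem shift_negLogTheta :
    (shiftSetting β).negLogTheta = ((processionNormalized fun i : Fin toyIndex.lstar => -1 + β (Setting.labelSucc i) : ℝ) : WithTop ℝ) := by
  rw [(shiftSetting β).negLogTheta_eq_of_thetaFinite (shift_thetaFinite β)]
  simp only [shift_thetaLocal, WithTop.untopD_coe, finsum_unique]

/-- `−|log(q)| = PN(j ↦ −2 + β j)`. [folklore] -/
theorem shift_negLogQ : (shiftSetting β).negLogQ = processionNormalized fun i : Fin toyIndex.lstar => -2 + β (Setting.labelSucc i) := by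
  unfold Setting.negLogQ
  simp only [shift_qLocal, finsum_unique]

/-- **The printed Statement of Cor. 3.12 HOLDS in P♮_β for EVERY `β`** (`−2 + β j ≤ −1 + β j` label by label, averaged). [folklore] -/
theorem shift_statement : (shiftSetting β).Statement :=
  ((shiftSetting β).statement_iff_real (shift_negLogTheta β)).2
    (by rw [shift_negLogQ]; exact Cor312Vol.processionNormalized_mono fun i => by linarith)

/-- **`|log(q)| > 0`** whenever the shift is `< 2` at every label of `𝔽_l^⋇` (every q-packet volume `−2 + β j` negative). [folklore] -/
theorem shift_absLogQPos (hβ : ∀ i : Fin toyIndex.lstar, β (Setting.labelSucc i) < 2) : (shiftSetting β).AbsLogQPos := by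
  show (shiftSetting β).negLogQ < 0
  rw [shift_negLogQ]
  unfold processionNormalized
  have hl0 : 0 < toyIndex.lstar := by decide
  have hl : (0 : ℝ) < (toyIndex.lstar : ℝ) := by exact_mod_cast hl0
  have hs : ∑ i : Fin toyIndex.lstar, (-2 + β (Setting.labelSucc i)) < 0 := by
    have hne : (Finset.univ : Finset (Fin toyIndex.lstar)).Nonempty := Finset.univ_nonempty_iff.2 ⟨⟨0, hl0⟩⟩
    calc ∑ i : Fin toyIndex.lstar, (-2 + β (Setting.labelSucc i)) < ∑ _i : Fin toyIndex.lstar, (0 : ℝ) :=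
          Finset.sum_lt_sum_of_nonempty hne fun i _ => by linarith [hβ i]
      _ = 0 := by simp
  exact div_neg_of_neg_of_pos hs hl

/-- All bridge hypotheses hold. [folklore] -/
theorem shift_bridgeHyps : BridgeHyps (shiftSetting β) where
  mono := fun _ _ _ _ _ _ hAB => shiftVol_mono β hAB
  image_adm := fun _ _ _ _ => trivial
  image_fin := fun _ => Set.toFinite _
  hul_nonempty := fun _ _ _ hH => ⟨0, zero_mem_of_mem_natHul hH⟩
  theta_nonempty := fun i vQ => by
    rw [(shift_regions_of_ne_zero β (Setting.labelSucc_ne_zero i) vQ).1]; exact ⟨0, zero_mem_halfPos _ vQ⟩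
  finite := shift_thetaFinite β

/-- Every Kummer image of the Θ-pilot is admissible. [folklore] -/
theorem shift_thetaRegionsAdm : ThetaRegionsAdm (shiftSetting β) := fun _ _ _ => trivial

/-! ## 5. The three pins, S through the genuine (Ind2)-move, the engine -/

/-- (hρ) ∧ (pΘ) for `segRegion`. [claim: Mochizuki2012, status: disputed] -/
theorem shift_thetaPinned : ThetaPinned (shiftFull β).toLatticeSituation (shiftSetting β) segRegion := by
  refine ⟨fun Φ _ Ψ j vQ => segRegion_equivariant Φ Ψ j vQ, fun m j vQ => ?_⟩
  show (shiftSetting β).thetaRegion m j vQ = segRegion (fun v _ => PsiNat v) j vQ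
  rw [shift_thetaRegion]
  by_cases hj : j = 0
  · subst hj; rw [(regionNat_zero 1 vQ).1, segRegion_zero]
  · rw [thetaRegionNat_one_of_ne_zero hj, segRegion_PsiNat hj]

/-- (pq′) for `qDatumNat`. [claim: Mochizuki2012, status: disputed] -/
theorem shift_qPinned : QPinned (shiftFull β).toLatticeSituation (shiftSetting β) segRegion qDatumNat := fun j vQ => by
  show (shiftSetting β).qRegion j vQ = segRegion qDatumNat j vQ
  rw [shift_qRegion]
  by_cases hj : j = 0
  · subst hj; rw [(regionNat_zero 1 vQ).2, segRegion_zero]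
  · rw [qRegionNat_one_of_ne_zero hj, segRegion_qDatumNat hj]

/-- (pL). [folklore] -/
theorem shift_pilotLink : Thm311ToCor312.PilotLink (shiftSetting β) :=
  ⟨Equiv.refl ℤ, by rw [(shift_pilots β).1, (shift_pilots β).2]; rfl⟩

/-- **The three pins hold in P♮_β.** [claim: Mochizuki2012, status: disputed] -/
theorem shift_pinnedRegions3 : PinnedRegions3 (shiftFull β).toLatticeSituation (shiftSetting β) segRegion qDatumNat :=
  ⟨⟨shift_thetaPinned β, shift_qPinned β⟩, shift_pilotLink β⟩

/-- **S = `PilotKummerIndRelated` HOLDS in P♮_β** through the (Ind2)-move `flipFamily` (one genuine indeterminacy; not the identity).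
[claim: Mochizuki2012, status: disputed] -/
theorem shift_pilotKummerIndRelated :
    PilotKummerIndRelated (shiftFull β).toLatticeSituation (shiftSetting β) segRegion qDatumNat := fun _ _ =>
  ⟨(shiftData β).map flipFamily, (shiftData β).map_mem_RLGP (Subgroup.subset_closure (Or.inr flipFamily_mem_Ind2Family)), rfl⟩

/-- NOT identified: on `𝔽_l^⋇` the q-region `halfNeg` is not the Θ-region `halfPos`. [folklore] -/
theorem shift_regions_ne {j : toyIndex.Label} (hj : j ≠ 0) (vQ : toyIndex.VQ) :
    (shiftSetting β).qRegion j vQ ≠ (shiftSetting β).thetaRegion3 j vQ := by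
  rw [(shift_regions_of_ne_zero β hj vQ).1, (shift_regions_of_ne_zero β hj vQ).2]
  intro h
  have h1 : lpt j vQ (-1) ∈ halfPos j vQ := h ▸ (lpt_neg_one_mem j vQ).1
  exact (lpt_neg_one_mem j vQ).2.2 h1

/-- **The SAT ENGINE at P♮_β**: an arbitrary candidate `H` (PR-1 arity) true at P♮_β with `β < 2` on `𝔽_l^⋇` is jointly satisfiable with
typed Thm. 3.11, `MultiradialCompat`, BridgeHyps, `|log(q)| > 0`, the three pins, S (through a genuine indeterminacy) and the Statement.
[folklore] -/
theorem satShift_of_holds (hβ : ∀ i : Fin toyIndex.lstar, β (Setting.labelSucc i) < 2)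
    (H : ∀ {T : ThetaIndex} (S : LatticeSituation T) (P : Cor312.Setting S.toSituation),
      ((∀ v : T.V, v ∈ T.Vbad → Set (S.L.StarPacket v)) → ∀ (j : T.Label) (vQ : T.VQ), Set (S.L.Packet j vQ)) →
      (∀ v : T.V, v ∈ T.Vbad → Set (S.L.StarPacket v)) → Prop)
    (h : H (shiftFull β).toLatticeSituation (shiftSetting β) segRegion qDatumNat) :
    ∃ (T : ThetaIndex) (F : FullSituation T) (P : Cor312.Setting F.toLatticeSituation.toSituation)
      (ρ : (∀ v : T.V, v ∈ T.Vbad → Set (F.L.StarPacket v)) → ∀ (j : T.Label) (vQ : T.VQ), Set (F.L.Packet j vQ))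
      (qK : ∀ v : T.V, v ∈ T.Vbad → Set (F.L.StarPacket v)),
      F.Statement ∧ F.MultiradialCompat ∧ BridgeHyps P ∧ P.AbsLogQPos ∧ PinnedRegions3 F.toLatticeSituation P ρ qK ∧
        PilotKummerIndRelated F.toLatticeSituation P ρ qK ∧ P.Statement ∧ H F.toLatticeSituation P ρ qK :=
  ⟨toyIndex, shiftFull β, shiftSetting β, segRegion, qDatumNat, shiftFull_statement β, shift_multiradialCompat β, shift_bridgeHyps β,
    shift_absLogQPos β hβ, shift_pinnedRegions3 β, shift_pilotKummerIndRelated β, shift_statement β, h⟩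

/-! ## 6. The honest-Θ instance `βθ j = −2·(j² − 1)` -/

/-- The HONEST-Θ normalisation: shift `−2·(j² − 1)` at label `j` (`0` at `j = 1`, `−6` at `j = 2`; `+2` at the zero label, which is never
summed), making the Θ-pilot's own packet volumes `−2·j²` = `j²`·(its label-`1` volume). MODEL DATA. [claim: Mochizuki2012, status: disputed] -/
def βθ : toyIndex.Label → ℝ := fun j => -2 * ((jsq j : ℝ) - 1)

/-- `βθ < 2` on `𝔽_l^⋇` (indeed `≤ 0`). [folklore] -/
theorem βθ_lt_two (i : Fin toyIndex.lstar) : βθ (Setting.labelSucc i) < 2 := by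
  unfold βθ
  have h : (1 : ℝ) ≤ (jsq (Setting.labelSucc i) : ℝ) := by exact_mod_cast PinnedHonest.one_le_jsq i
  linarith

/-- **The numbers of P♮_{βθ}**: hull volumes `thetaLocal = −1, −7`, own Θ-volumes `−2, −8` (= `−2·j²`), q-volumes `−2, −8` at the labels
`1, 2`; `−|log(Θ)| = −4`, `−|log(q)| = −5` (Statement strict). [folklore] -/
theorem shiftθ_numbers :
    (shiftSetting βθ).thetaLocal (Setting.labelSucc ⟨0, by decide⟩) () = ((-1 : ℝ) : WithTop ℝ) ∧
      (shiftSetting βθ).thetaLocal (Setting.labelSucc ⟨1, by decide⟩) () = ((-7 : ℝ) : WithTop ℝ) ∧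
      (∀ m : ℤ, ((shiftSituation βθ).D (shiftSetting βθ).n).logvol _ ()
          ((shiftSetting βθ).thetaRegion m (Setting.labelSucc ⟨0, by decide⟩) ()) = -2) ∧
      (∀ m : ℤ, ((shiftSituation βθ).D (shiftSetting βθ).n).logvol _ ()
          ((shiftSetting βθ).thetaRegion m (Setting.labelSucc ⟨1, by decide⟩) ()) = -8) ∧
      (shiftSetting βθ).negLogTheta = ((-4 : ℝ) : WithTop ℝ) ∧ (shiftSetting βθ).negLogQ = -5 := by
  have hj1 : jsq (Setting.labelSucc (T := toyIndex) ⟨0, by decide⟩) = 1 := by decide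
  have hj4 : jsq (Setting.labelSucc (T := toyIndex) ⟨1, by decide⟩) = 4 := by decide
  have hb1 : βθ (Setting.labelSucc ⟨0, by decide⟩) = 0 := by unfold βθ; rw [hj1]; norm_num
  have hb2 : βθ (Setting.labelSucc ⟨1, by decide⟩) = -6 := by unfold βθ; rw [hj4]; norm_num
  refine ⟨by rw [shift_thetaLocal, hb1]; norm_num, by rw [shift_thetaLocal, hb2]; norm_num,
    fun m => by rw [shift_logvol_thetaRegion, hb1]; norm_num, fun m => by rw [shift_logvol_thetaRegion, hb2]; norm_num, ?_, ?_⟩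
  · rw [shift_negLogTheta]
    congr 1
    show (∑ i : Fin 2, (-1 + βθ (Setting.labelSucc i))) / ((2 : ℕ) : ℝ) = _
    rw [Fin.sum_univ_two]
    change (-1 + βθ (Setting.labelSucc (T := toyIndex) ⟨0, by decide⟩) + (-1 + βθ (Setting.labelSucc (T := toyIndex) ⟨1, by decide⟩))) /
      ((2 : ℕ) : ℝ) = _
    rw [hb1, hb2]; norm_num
  · rw [shift_negLogQ]
    show (∑ i : Fin 2, (-2 + βθ (Setting.labelSucc i))) / ((2 : ℕ) : ℝ) = _
    rw [Fin.sum_univ_two]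
    change (-2 + βθ (Setting.labelSucc (T := toyIndex) ⟨0, by decide⟩) + (-2 + βθ (Setting.labelSucc (T := toyIndex) ⟨1, by decide⟩))) /
      ((2 : ℕ) : ℝ) = _
    rw [hb1, hb2]; norm_num

end NaturalShiftWitness

end Summit.ABC.IUTFork.Cor312Vol

end
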